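import Summits.ResolutionOfSingularities.ResolutionOfSingularities.Theorems.PurelyInseparableDim4InScopeWinCert
import HarnessLib
import HarnessLib.Audit.Tags

/-!
# Purely inseparable fourfolds — BOOKS-FREE win rows with EXTERNAL children for the plain GLOBAL game
# (cell res-dim4-pi; def-free kit for the «pure d = 0 leaves win globally» batch, WORD #60 D3a)
# [OURS · counted 0 · certificate rows for OUR frame v4, not about resolution]

Width seat `res-dim4-p-10` (g2).  res-dim4-p-14's `WinCertSound.winCertB` certifies `StateWins q` (A's
attractor of the GLOBAL game of record: `Edge`, every `K`-rational reply incl. along the centre) by ONE list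
whose children occur later in the same list and are matched WITH their books `(r, exc)`; such lists are
quadratic under `decide`.  Two remarks give small kernel objects (no new definitions):

* **the game reads `F` only** — `stateWins_rebook : StateWins q s → StateWins q ⟨s.F, r', exc'⟩`; so a
  node is the statement `∀ r exc, StateWins q ⟨evalT L, r, exc⟩` and children are matched on `F` alone;
* **children may be EXTERNAL theorems** — `stateWins_of_row`: ONE row `(L, S)` whose Boolean check (spelled
  out in the hypothesis: `S` permissible, every reply `(j ∈ S, b, b_j = 0)` non-equimultiple / kills `F` /
  lands on a polynomial of the child list `C`) passes by `decide`, plus the children's theorems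
  (`all_cons … all_nil`), gives the node's theorem.

`inScopeStateWins_of_forall_books`: such a node is in-scope escapable for every booking.  Acceptance over
`𝔽₂`: `x₀x₁` (no reply) and specimen X0's parent `x₀³(1 + x₁)` in two rows.  Finite field (`[Fintype K]`)
for the Boolean row only.  Nothing here proves resolution of singularities in dimension ≥ 4 / characteristic
`p`; counted 0; AI work, weaker than expert review. bears_on: LADDER-RESOLUTION:D157-DOOR2 (res-dim4-pi ·
WORD #60 D3a · F4-C instrument). Supports stmt-ResolutionOfSingularities-16155 (helper).
-/

set_option linter.dupNamespace false

noncomputable section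

namespace Summit.ResolutionOfSingularities.ResolutionOfSingularities.Theorems.PIDim4

namespace WinCertF

open Literature.AlgebraicGeometry.Resolution
open StepKit WinCertSound InScopeWinCert

variable {K : Type} [Field K] [DecidableEq K]

/-! ## 1. The game reads `F` only -/

/-- **Re-booking keeps A's wins**: the legal moves, the replies and the `F` of every successor depend on
`F` alone, so `StateWins q s` transfers to every state with the same `F`. [folklore] -/
theorem stateWins_rebook {q : ℕ} {s : State K} (h : StateWins q s) (r : Fin 4 →₀ ℕ)
    (exc : Finset (Fin 4)) : StateWins q (⟨s.F, r, exc⟩ : State K) := by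
  unfold StateWins at h ⊢
  induction h generalizing r exc with
  | terminal h0 => exact Game.Wins.terminal h0
  | @move t S hm _ ih =>
    refine Game.Wins.move (m := S) hm ?_
    rintro t' ⟨j, b, hj, hbj, heq, hne, rfl⟩
    have hsucc : Edge q S t (CentreBlowup.step q S j b t) := ⟨j, b, hj, hbj, heq, hne, rfl⟩
    exact ih _ hsucc (CentreBlowup.step q S j b ⟨t.F, r, exc⟩).r
      (CentreBlowup.step q S j b ⟨t.F, r, exc⟩).exc

/-- A node won for every booking is in-scope escapable for every booking. [folklore] -/
theorem inScopeStateWins_of_forall_books {q : ℕ} {F : MvPolynomial (Fin 4) K}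
    (h : ∀ (r : Fin 4 →₀ ℕ) (exc : Finset (Fin 4)), StateWins q (⟨F, r, exc⟩ : State K))
    (r : Fin 4 →₀ ℕ) (exc : Finset (Fin 4)) : InScopeStateWins q (⟨F, r, exc⟩ : State K) :=
  inScopeStateWins_of_stateWins (h r exc)

/-- The empty child list is won. [folklore] -/
theorem all_nil (q : ℕ) : ∀ L' ∈ ([] : List (Terms 4 K)), ∀ (r : Fin 4 →₀ ℕ) (exc : Finset (Fin 4)),
    StateWins q (⟨evalT L', r, exc⟩ : State K) :=
  fun _ h => absurd h List.not_mem_nil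

/-- Consing a won child polynomial. [folklore] -/
theorem all_cons {q : ℕ} {L : Terms 4 K} {C : List (Terms 4 K)}
    (hL : ∀ (r : Fin 4 →₀ ℕ) (exc : Finset (Fin 4)), StateWins q (⟨evalT L, r, exc⟩ : State K))
    (hC : ∀ L' ∈ C, ∀ (r : Fin 4 →₀ ℕ) (exc : Finset (Fin 4)), StateWins q (⟨evalT L', r, exc⟩ : State K)) :
    ∀ L' ∈ L :: C, ∀ (r : Fin 4 →₀ ℕ) (exc : Finset (Fin 4)), StateWins q (⟨evalT L', r, exc⟩ : State K) :=
  fun L' h => by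
    rcases List.mem_cons.mp h with rfl | h'
    · exact hL
    · exact hC L' h'

/-! ## 2. One books-free row with external children -/

/-- **SOUNDNESS OF A BOOKS-FREE ROW.** Children `C` all won (for every booking); the row check, spelled
out: `S` is permissible for `evalT L` and every `K`-rational reply `(j ∈ S, b, b_j = 0)` is not
equimultiple, or kills `F`, or its `F` equals (as a polynomial) some member of `C`.  Then `evalT L` is won
for every booking. [folklore] -/
theorem stateWins_of_row [Fintype K] {q : ℕ} {C : List (Terms 4 K)}
    (hC : ∀ L' ∈ C, ∀ (r : Fin 4 →₀ ℕ) (exc : Finset (Fin 4)), StateWins q (⟨evalT L', r, exc⟩ : State K))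
    {L : Terms 4 K} {S : Finset (Fin 4)}
    (h : (permB q S L && decide (∀ j ∈ S, ∀ b : Fin 4 → K, b j = 0 →
      (!(equiB q S j b ⟨L, fun _ => 0, ∅⟩) || StepKit.equivB (stepD q S j b ⟨L, fun _ => 0, ∅⟩).L [] ||
        C.any (fun L' => StepKit.equivB (stepD q S j b ⟨L, fun _ => 0, ∅⟩).L L')) = true)) = true) :
    ∀ (r : Fin 4 →₀ ℕ) (exc : Finset (Fin 4)), StateWins q (⟨evalT L, r, exc⟩ : State K) := by
  intro r exc
  rw [Bool.and_eq_true, decide_eq_true_eq] at h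
  obtain ⟨hS, hall⟩ := h
  set s₀ : SData 4 K := ⟨L, fun _ => 0, ∅⟩ with hs₀
  unfold StateWins
  refine Game.Wins.move (m := S) ((isPermissibleCentre_iff q S L).mpr hS) ?_
  rintro s' ⟨j, b, hj, hbj, heq, hne, rfl⟩
  have h := hall j hj b hbj
  rw [Bool.or_eq_true, Bool.or_eq_true] at h
  -- the step of the booked state and of `s₀` have the same `F`
  have hstepF : (CentreBlowup.step q S j b (⟨evalT L, r, exc⟩ : State K)).F =
      (CentreBlowup.step q S j b s₀.toState).F := rfl
  have heq₀ : CentreBlowup.IsEquimultiplePoint q S j b s₀.toState := heq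
  rcases h with (h1 | h2) | h3
  · rw [Bool.not_eq_true', ← Bool.not_eq_true] at h1
    exact absurd ((isEquimultiplePoint_iff q S j b s₀).mp heq₀) h1
  · refine absurd h2 ?_
    rw [Bool.not_eq_true]
    exact (step_F_ne_zero_iff q S j b s₀).mp (hstepF ▸ hne)
  · obtain ⟨L', hL', hLL⟩ := List.any_eq_true.mp h3
    have hF' : (CentreBlowup.step q S j b (⟨evalT L, r, exc⟩ : State K)).F = evalT L' := by
      rw [hstepF, step_toState, SData.toState_F, (evalT_eq_iff_equivB _ L').mpr hLL]
    have hw := hC L' hL' (CentreBlowup.step q S j b (⟨evalT L, r, exc⟩ : State K)).r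
      (CentreBlowup.step q S j b (⟨evalT L, r, exc⟩ : State K)).exc
    rw [← hF'] at hw
    exact hw

/-! ## 3. Acceptance over `𝔽₂` -/

/-- `x₀x₁` is won with no reply: centre `{x₀, x₁}`, both charts keep a linear term. [folklore] -/
theorem stateWins_x0x1 : ∀ (r : Fin 4 →₀ ℕ) (exc : Finset (Fin 4)),
    StateWins 2 (⟨evalT ([(![1, 1, 0, 0], 1)] : Terms 4 (ZMod 2)), r, exc⟩ : State (ZMod 2)) :=
  stateWins_of_row (all_nil 2) (S := {0, 1}) (by decide)

/-- `x₀³(1 + x₁)` (specimen X0's parent) is won in two books-free rows: centre `{x₀}`, child `x₀x₁` — the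
along-centre reply, matched on `F` alone (its books differ from a leaf's). [folklore] -/
theorem stateWins_x0cube : ∀ (r : Fin 4 →₀ ℕ) (exc : Finset (Fin 4)),
    StateWins 2 (⟨evalT ([(![3, 0, 0, 0], 1), (![3, 1, 0, 0], 1)] : Terms 4 (ZMod 2)), r, exc⟩ :
      State (ZMod 2)) :=
  stateWins_of_row (C := [[(![1, 1, 0, 0], 1)]]) (all_cons stateWins_x0x1 (all_nil 2)) (S := {0})
    (by decide)

/-- Hence every booking of `x₀³ + x₀³x₁` is in-scope escapable over `𝔽₂`. [folklore] -/
theorem inScopeStateWins_x0cube (r : Fin 4 →₀ ℕ) (exc : Finset (Fin 4)) :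
    InScopeStateWins 2 (⟨evalT ([(![3, 0, 0, 0], 1), (![3, 1, 0, 0], 1)] : Terms 4 (ZMod 2)), r, exc⟩ :
      State (ZMod 2)) :=
  inScopeStateWins_of_forall_books stateWins_x0cube r exc

end WinCertF

end Summit.ResolutionOfSingularities.ResolutionOfSingularities.Theorems.PIDim4

end
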